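import Summits.QuantumFields.YangMills.Theorems.FemtoTransferGapLevelsDecay
import Literature.Analysis.OperatorTheory.CompactPositiveEigenSequence
import HarnessLib

/-!
# The COMPLETE physical eigenbasis of the zero-flux transfer operator at fixed lattice (`SU(2)`, `β > 0`)

Support module of the `FemtoTransferGap` group (fleet service by seat ym-infvol-p2; route `LuscherReduction`, bears on crux `RunningReduction`
stmt-QuantumFields-19978 — the spectral layer of the registered stub `TT.stub_traceFormula` of line «KTR» rev 7 PART 5 — and on crux `OneSiteLevels`
stmt-QuantumFields-20007).  `FemtoTransferGapSpectral` / `FemtoTransferGapLevelsPos` give, for each `k` separately, SOME physical `l2`-orthonormal exact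
eigenfamily `φ₀ … φ_k` realising `λ_j = levelValue su2Rep L β j`.  Here ONE family serves ALL levels at once, and it is COMPLETE modulo the kernel:

**`exists_isPhys_eigenseq (hβ : 0 < β)`**: a sequence `e : ℕ → physSubmodule L` with
* `l2 (e i) (e l) = δ_{il}` (orthonormal), `K_β (e k) = λ_k • e k` POINTWISE with `λ_k = levelValue su2Rep L β k` for EVERY `k`;
* Courant–Fischer DOMINATION at every level: a physical `ψ ⊥ e_0 … e_{k−1}` has `⟨ψ,K_βψ⟩ ≤ λ_k‖ψ‖²`;
* COMPLETENESS MOD KERNEL: every class `v` of the physical closed subspace `physL2 L` orthogonal to all `toL2 (e k)` is annihilated by the kernel,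
  `∫ K_β(U,V) v(V) dV = 0` for EVERY `U` (a.e. by `⟪v, A v⟫ ≤ λ_k‖v‖² → 0` and positivity; everywhere by continuity of the kernel integral).

Proof: Lit `exists_orthonormal_eigenseq` (dependent choice of next eigenvectors of the compact positive compression, Reed–Simon I VI.16 / IV XIII.1)
+ `isGLB_minmax_of_dense_constraints_nat` over the dense physical core identify `ev k = levelValue k` (the Fin-indexed argument of
`FemtoTransferGapSpectral.exists_isPhys_eigenfamily`, verbatim in `ℕ` form); representatives `λ_k⁻¹ K_β e_k` (`0 < λ_k` by `levelValue_su2Rep_pos`);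
completeness from domination + `tendsto_levelValue_atTop_zero` + `⟪x,Tx⟫ = 0 ⇒ Tx = 0` for positive symmetric `T` (`apply_eq_zero_of_inner_self_eq_zero`).

HONEST FRAMING: fixed-lattice functional analysis of the femto rung R2b1; nothing here is uniform in `L`, infinite volume, a mass gap or Clay.
References: M. Reed, B. Simon I (1980) Thm. VI.16 [cite: ReedSimonI1980]; IV (1978) XIII.1–2 [cite: ReedSimonIV1978]; [cite: Luscher1977].
-/

set_option autoImplicit false

noncomputable section

open MeasureTheory Filter Topology Real
open Literature.MathematicalPhysics.QuantumFieldTheory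
open Literature.MathematicalPhysics.QuantumLattice
open Literature.Analysis.OperatorTheory.YMMatrixModel
open Literature.Analysis.OperatorTheory
open scoped InnerProductSpace

namespace Summit.QuantumFields.YangMills.Theorems.FemtoTransferGap

open PhysL2

/-! ## §1 A positive symmetric operator vanishes where its form vanishes -/

/-- **`⟪x, T x⟫ = 0 ⟹ T x = 0`** for a symmetric operator with non-negative form on a real inner product space (polarisation:
`0 ≤ ⟪x + t y, T(x + t y)⟫ = 2t⟪y, T x⟫ + t²⟪y, T y⟫` for all real `t` forces `⟪y, T x⟫ = 0`, take `y = T x`). [folklore] -/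
theorem apply_eq_zero_of_inner_self_eq_zero {G : Type*} [NormedAddCommGroup G] [InnerProductSpace ℝ G] (T : G →L[ℝ] G)
    (hsym : ∀ x y : G, ⟪T x, y⟫_ℝ = ⟪x, T y⟫_ℝ) (hpos : ∀ x : G, 0 ≤ ⟪x, T x⟫_ℝ) {x : G} (hx : ⟪x, T x⟫_ℝ = 0) :
    T x = 0 := by
  -- `⟪y, T x⟫ = 0` for every `y`
  have horth : ∀ y : G, ⟪y, T x⟫_ℝ = 0 := by
    intro y
    have h1 : ⟪x, T y⟫_ℝ = ⟪y, T x⟫_ℝ := by rw [← hsym x y]; exact real_inner_comm y (T x)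
    have hquad : ∀ t : ℝ, 0 ≤ ⟪y, T y⟫_ℝ * (t * t) + 2 * ⟪y, T x⟫_ℝ * t + 0 := by
      intro t
      have h0 := hpos (x + t • y)
      have hexp : ⟪x + t • y, T (x + t • y)⟫_ℝ = ⟪y, T y⟫_ℝ * (t * t) + 2 * ⟪y, T x⟫_ℝ * t + 0 := by
        simp only [map_add, map_smul, inner_add_left, inner_add_right, real_inner_smul_left, real_inner_smul_right, hx, h1]
        ring
      rwa [hexp] at h0
    have hd := discrim_le_zero hquad
    rw [discrim] at hd
    nlinarith [hd, sq_nonneg ⟪y, T x⟫_ℝ]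
  have h := horth (T x)
  rwa [real_inner_self_eq_norm_sq, sq_eq_zero_iff, norm_eq_zero] at h

/-! ## §2 The complete physical eigenbasis -/

variable {L : ℕ} [NeZero L]

/-- The kernel integral `U ↦ ∫ K_β(U,V) v(V) dV` of an `L²` class is continuous in `U` (continuous bounded kernel, dominated convergence). [folklore] -/
theorem continuous_transferApply_coe (β : ℝ) (v : Lp ℝ 2 (configMeasure SU2 L)) :
    Continuous fun U : GaugeConfig 3 L SU2 => ∫ V, transferKernel su2Rep β U V * v V ∂configMeasure SU2 L := by
  haveI : SecondCountableTopology (Matrix (Fin 2) (Fin 2) ℂ) := inferInstanceAs (SecondCountableTopology (Fin 2 → Fin 2 → ℂ))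
  haveI : SecondCountableTopology SU2 := secondCountableTopology_su2
  obtain ⟨M, hM0, hM⟩ := exists_norm_transferKernel_le (L := L) β
  set f : GaugeConfig 3 L SU2 → ℝ := (v : GaugeConfig 3 L SU2 → ℝ) with hf
  have hfi : Integrable f (configMeasure SU2 L) := MemLp.integrable one_le_two (Lp.memLp v)
  have hfm : AEStronglyMeasurable f (configMeasure SU2 L) := hfi.aestronglyMeasurable
  refine continuous_of_dominated (F := fun U V => transferKernel su2Rep β U V * f V) (bound := fun V => M * ‖f V‖)
    (fun U => ?_) (fun U => ae_of_all _ fun V => ?_) (hfi.norm.const_mul M) (ae_of_all _ fun V => ?_)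
  · exact ((continuous_transferKernel_right β U).measurable.aestronglyMeasurable).mul hfm
  · rw [norm_mul]; exact mul_le_mul_of_nonneg_right (hM U V) (norm_nonneg _)
  · have hg : Continuous fun U : GaugeConfig 3 L SU2 => (U, V) := Continuous.prodMk_left V
    have hK2 : Continuous fun p : GaugeConfig 3 L SU2 × GaugeConfig 3 L SU2 => transferKernel su2Rep β p.1 p.2 :=
      continuous_transferKernel su2Rep continuous_su2Rep β
    have hK : Continuous fun U : GaugeConfig 3 L SU2 => transferKernel su2Rep β U V := by
      have h := hK2.comp hg
      simpa only [Function.comp_def] using h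
    exact hK.mul continuous_const

set_option maxHeartbeats 1600000 in
/-- **THE COMPLETE PHYSICAL EIGENBASIS at fixed lattice** (`β > 0`, every `L ≥ 1`).  There is ONE sequence `e : ℕ → physSubmodule L` of physical
zero-flux test functions, `l2`-ORTHONORMAL, of EXACT eigenfunctions `K_β (e k) = λ_k (e k)` pointwise with `λ_k = levelValue su2Rep L β k` for EVERY
`k`, which DOMINATES (a physical `ψ ⊥ e_0,…,e_{k−1}` has `⟨ψ,K_βψ⟩ ≤ λ_k ‖ψ‖²`) and is COMPLETE MODULO THE KERNEL: every class `v ∈ physL2 L` with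
`⟪toL2 (e k), v⟫ = 0` for all `k` has `∫ K_β(U,V) v(V) dV = 0` for every `U`.
Lit `exists_orthonormal_eigenseq` + `isGLB_minmax_of_dense_constraints_nat` (identification over the dense physical core as in
`FemtoTransferGapSpectral.exists_isPhys_eigenfamily`), `levelValue_su2Rep_pos` (representatives `λ_k⁻¹ K_β e_k`), `tendsto_levelValue_atTop_zero` +
`apply_eq_zero_of_inner_self_eq_zero` (completeness), `continuous_transferApply_coe` (everywhere). [cite: ReedSimonI1980, Thm. VI.16] [cite: ReedSimonIV1978, Thm. XIII.1–2] -/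
theorem exists_isPhys_eigenseq {β : ℝ} (hβ : 0 < β) :
    ∃ e : ℕ → physSubmodule L,
      (∀ i l, l2 ((e i : physSubmodule L) : GaugeConfig 3 L SU2 → ℝ) (e l) = if i = l then 1 else 0) ∧
      (∀ k, transferApply β ((e k : physSubmodule L) : GaugeConfig 3 L SU2 → ℝ) =
        levelValue su2Rep L β k • ((e k : physSubmodule L) : GaugeConfig 3 L SU2 → ℝ)) ∧
      (∀ (k : ℕ) (ψ : GaugeConfig 3 L SU2 → ℝ), IsPhys ψ →
        (∀ i, i < k → l2 ψ ((e i : physSubmodule L) : GaugeConfig 3 L SU2 → ℝ) = 0) →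
          qform su2Rep β ψ ψ ≤ levelValue su2Rep L β k * l2 ψ ψ) ∧
      (∀ v : Lp ℝ 2 (configMeasure SU2 L), v ∈ physL2 L → (∀ k, ⟪toL2 (e k), v⟫_ℝ = 0) →
        ∀ U : GaugeConfig 3 L SU2, ∫ V, transferKernel su2Rep β U V * v V ∂configMeasure SU2 L = 0) := by
  classical
  have hβ0 : 0 ≤ β := hβ.le
  -- the `L²` operator, its compression to the physical closed subspace `V`
  obtain ⟨A, hA, hsa, hc⟩ := exists_transferOpL2 (L := L) β
  haveI : CompleteSpace (physL2 L) := isClosed_physL2.completeSpace_coe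
  obtain ⟨T, hT, hTsa, hTc⟩ := exists_compression A (physL2 L) (fun v hv => apply_mem_physL2 hA hv)
  have hTsa' : IsSelfAdjoint T := hTsa hsa
  have hTc' : IsCompactOperator T := hTc hc
  have hTinner : ∀ x : physL2 L, ⟪x, T x⟫_ℝ = ⟪(x : Lp ℝ 2 (configMeasure SU2 L)), A x⟫_ℝ := fun x =>
    (compression_inner_norm hT x).1
  have hpos : ∀ x : physL2 L, 0 ≤ RCLike.re ⟪x, T x⟫_ℝ := fun x => by
    rw [RCLike.re_to_real, hTinner]
    exact inner_apply_nonneg hA hβ0 x.2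
  have hpos' : ∀ x : physL2 L, 0 ≤ ⟪x, T x⟫_ℝ := fun x => by simpa using hpos x
  have hsym : ∀ x y : physL2 L, ⟪T x, y⟫_ℝ = ⟪x, T y⟫_ℝ := fun x y =>
    (ContinuousLinearMap.isSelfAdjoint_iff_isSymmetric.1 hTsa') x y
  -- the eigen-sequence and the min–max principle over the dense core (ℕ form)
  obtain ⟨e, ev, hon, heig, hanti, hdom⟩ := exists_orthonormal_eigenseq (𝕜 := ℝ) not_finiteDimensional_physL2 hTsa' hTc' hpos
  have heig' : ∀ j, T (e j) = ev j • e j := fun j => by simpa using heig j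
  have hAe : ∀ j, A (e j : Lp ℝ 2 (configMeasure SU2 L)) = ev j • (e j : Lp ℝ 2 (configMeasure SU2 L)) := fun j => by
    rw [← hT, heig', Submodule.coe_smul]
  have hglb := fun j : ℕ =>
    isGLB_minmax_of_dense_constraints_nat (𝕜 := ℝ) hsym hpos hon heig hanti hdom (physCoreIn L) dense_physCoreIn j
  -- dictionary on the core
  have hcoreT : ∀ ψ : physSubmodule L, ⟪toV ψ, T (toV ψ)⟫_ℝ = qform su2Rep β (ψ : GaugeConfig 3 L SU2 → ℝ) ψ := fun ψ => by
    rw [hTinner]; exact inner_apply_toL2 hA ψ ψ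
  have hcoreN : ∀ ψ : physSubmodule L, ‖toV ψ‖ ^ 2 = l2 (ψ : GaugeConfig 3 L SU2 → ℝ) ψ := fun ψ => by
    rw [Submodule.coe_norm]; exact norm_sq_toL2 ψ
  have hcoreI : ∀ ψ φ : physSubmodule L, ⟪toV ψ, toV φ⟫_ℝ = l2 (ψ : GaugeConfig 3 L SU2 → ℝ) φ := fun ψ φ => by
    rw [Submodule.coe_inner]; exact inner_toL2 ψ φ
  -- IDENTIFICATION `ev j = levelValue j` for every `j : ℕ`
  have hev : ∀ j : ℕ, ev j = levelValue su2Rep L β j := by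
    intro j
    apply le_antisymm
    · -- `ev j ≤ levelValue j`
      unfold levelValue
      refine le_csInf ⟨_, fun _ _ => (1 : ℝ), fun _ => isPhys_const 1, rfl⟩ ?_
      rintro s ⟨φs, hφ, rfl⟩
      refine (hglb j).1 ⟨fun l => toV ⟨φs l, hφ l⟩, fun l => toV_mem_physCoreIn _, fun x hx hperp => ?_⟩
      obtain ⟨ψ, hψx⟩ := mem_physCore_iff.mp (mem_physCoreIn_iff.mp hx)
      have hxψ : x = toV ψ := Subtype.ext hψx.symm
      subst hxψ
      rw [RCLike.re_to_real, hcoreT, hcoreN]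
      have hperp' : ∀ l, l2 (ψ : GaugeConfig 3 L SU2 → ℝ) (φs l) = 0 := fun l => by
        have h := hperp l
        rw [hcoreI] at h
        rw [l2_comm]
        exact h
      rcases (l2_self_nonneg (ψ : GaugeConfig 3 L SU2 → ℝ)).eq_or_lt with h0 | hpos''
      · rw [← h0, mul_zero, qform_eq_zero_of_l2_eq_zero β (isPhys_coe ψ) h0.symm]
      · have hmem : qform su2Rep β (ψ : GaugeConfig 3 L SU2 → ℝ) ψ / l2 (ψ : GaugeConfig 3 L SU2 → ℝ) ψ ∈
            rayleighSet su2Rep L β (fun χ => ∀ i, l2 χ (φs i) = 0) := ⟨ψ, isPhys_coe ψ, hperp', hpos'', rfl⟩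
        have hle := le_csSup (bddAbove_rayleighSet su2Rep continuous_su2Rep β _) hmem
        rwa [div_le_iff₀ hpos''] at hle
    · -- `levelValue j ≤ ev j`
      refine le_of_forall_pos_lt_add fun ε hε => ?_
      obtain ⟨s, ⟨χ, hχD, hχ⟩, -, hslt⟩ := (hglb j).exists_between (lt_add_of_pos_right _ hε)
      have hχψ : ∀ l, ∃ ψ : physSubmodule L, toV ψ = χ l := fun l => by
        obtain ⟨ψ, hψ⟩ := mem_physCore_iff.mp (mem_physCoreIn_iff.mp (hχD l))
        exact ⟨ψ, Subtype.ext hψ⟩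
      choose ψs hψs using hχψ
      have hφ : ∀ l, IsPhys ((ψs l : physSubmodule L) : GaugeConfig 3 L SU2 → ℝ) := fun l => isPhys_coe _
      have h1 : levelValue su2Rep L β j ≤ sSup (rayleighSet su2Rep L β fun χ' => ∀ i, l2 χ' ((ψs i : physSubmodule L) : _) = 0) := by
        unfold levelValue
        refine csInf_le ⟨0, ?_⟩ ⟨fun i => ((ψs i : physSubmodule L) : GaugeConfig 3 L SU2 → ℝ), hφ, rfl⟩
        rintro t ⟨φs', -, rfl⟩
        refine Real.sSup_nonneg ?_
        rintro r ⟨ψ', hψ', -, hp, rfl⟩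
        exact div_nonneg (qform_su2Rep_self_nonneg hβ0 hψ') hp.le
      have h2 : sSup (rayleighSet su2Rep L β fun χ' => ∀ i, l2 χ' ((ψs i : physSubmodule L) : _) = 0) ≤ max s 0 := by
        refine Real.sSup_le ?_ (le_max_right _ _)
        rintro r ⟨ψ', hψ', hperp, hp, rfl⟩
        refine (le_max_left s 0).trans' ?_
        rw [div_le_iff₀ hp]
        have hx : toV ⟨ψ', hψ'⟩ ∈ physCoreIn L := toV_mem_physCoreIn _
        have hperpV : ∀ l, ⟪χ l, toV ⟨ψ', hψ'⟩⟫_ℝ = 0 := fun l => by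
          rw [← hψs l, hcoreI, l2_comm]; exact hperp l
        have h := hχ (toV ⟨ψ', hψ'⟩) hx hperpV
        rwa [RCLike.re_to_real, hcoreT, hcoreN] at h
      have h3 : max s 0 < ev j + ε := max_lt hslt (lt_add_of_le_of_pos (ev_seq_nonneg hpos hon heig j) hε)
      linarith
  -- positivity of every eigenvalue
  have hevpos : ∀ j : ℕ, 0 < ev j := fun j => by rw [hev]; exact levelValue_su2Rep_pos hβ j
  -- REPRESENTATIVES `φ_j := ev_j⁻¹ • K_β e_j`
  have hKe : ∀ j, IsPhys (transferApply β ((e j : Lp ℝ 2 (configMeasure SU2 L)) : GaugeConfig 3 L SU2 → ℝ)) := fun j =>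
    isPhys_transferApply_coe β (e j).2
  set φ : ℕ → physSubmodule L := fun j => (ev j)⁻¹ • ⟨_, hKe j⟩ with hφdef
  -- the class of `φ_j` is `e_j`
  have hclass : ∀ j, toL2 (φ j) = (e j : Lp ℝ 2 (configMeasure SU2 L)) := fun j => by
    rw [hφdef]
    simp only
    rw [map_smul, toL2_transferApply_coe hA (e j).2, hAe, smul_smul, inv_mul_cancel₀ (hevpos j).ne', one_smul]
  have hcoeφ : ∀ j, ((φ j : physSubmodule L) : GaugeConfig 3 L SU2 → ℝ)
      = (ev j)⁻¹ • transferApply β ((e j : Lp ℝ 2 (configMeasure SU2 L)) : GaugeConfig 3 L SU2 → ℝ) := fun j => rfl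
  have hclassV : ∀ j, toV (φ j) = e j := fun j => Subtype.ext (hclass j)
  refine ⟨φ, fun i l => ?_, fun i => ?_, fun k ψ hψ hperp => ?_, fun v hv hperp U => ?_⟩
  · -- orthonormality
    rw [← inner_toL2, hclass, hclass, ← Submodule.coe_inner]
    exact (orthonormal_iff_ite.mp hon) i l
  · -- the eigen-equation, pointwise
    have hae : transferApply β ((e i : Lp ℝ 2 (configMeasure SU2 L)) : GaugeConfig 3 L SU2 → ℝ) =ᵐ[configMeasure SU2 L]
        ev i • ((e i : Lp ℝ 2 (configMeasure SU2 L)) : GaugeConfig 3 L SU2 → ℝ) := by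
      have h1 := hA (e i : Lp ℝ 2 (configMeasure SU2 L))
      rw [hAe] at h1
      filter_upwards [h1, Lp.coeFn_smul (ev i) (e i : Lp ℝ 2 (configMeasure SU2 L))] with U hU hs
      rw [transferApply_apply, ← hU, hs]
    have hKK : transferApply β (transferApply β ((e i : Lp ℝ 2 (configMeasure SU2 L)) : GaugeConfig 3 L SU2 → ℝ)) =
        ev i • transferApply β ((e i : Lp ℝ 2 (configMeasure SU2 L)) : GaugeConfig 3 L SU2 → ℝ) := by
      rw [transferApply_congr_ae hae, transferApply_smul]
    rw [← hev, hcoeφ]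
    rw [transferApply_smul, hKK, smul_smul, smul_smul, inv_mul_cancel₀ (hevpos i).ne', mul_inv_cancel₀ (hevpos i).ne']
  · -- domination at level `k`
    set x : physL2 L := toV ⟨ψ, hψ⟩ with hx
    have h := hdom k x (fun i hi => by
      rw [hx, ← hclassV i, hcoreI, l2_comm]
      exact hperp i hi)
    rw [RCLike.re_to_real, hx, hcoreT, hcoreN, hev] at h
    exact h
  · -- completeness modulo the kernel
    set x : physL2 L := ⟨v, hv⟩ with hx
    have hperpx : ∀ i, ⟪e i, x⟫_ℝ = 0 := fun i => by
      have h1 : ⟪e i, x⟫_ℝ = ⟪(e i : Lp ℝ 2 (configMeasure SU2 L)), v⟫_ℝ := Submodule.coe_inner _ _ _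
      rw [h1, ← hclass i]; exact hperp i
    -- `⟪x, T x⟫ ≤ ev k ‖x‖²` for every `k`, and `ev k → 0`
    have hle : ∀ k, ⟪x, T x⟫_ℝ ≤ ev k * ‖x‖ ^ 2 := fun k => by
      have h := hdom k x (fun i _ => hperpx i)
      rwa [RCLike.re_to_real] at h
    have hev0 : Tendsto ev atTop (𝓝 0) := by
      have h := tendsto_levelValue_atTop_zero (L := L) hβ
      exact h.congr fun k => (hev k).symm
    have hlim : Tendsto (fun k => ev k * ‖x‖ ^ 2) atTop (𝓝 0) := by
      simpa using hev0.mul_const (‖x‖ ^ 2)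
    have hxx : ⟪x, T x⟫_ℝ = 0 :=
      le_antisymm (ge_of_tendsto' hlim hle) (hpos' x)
    have hTx : T x = 0 := apply_eq_zero_of_inner_self_eq_zero T hsym hpos' hxx
    have hAv : A v = 0 := by
      have h := hT x
      rw [hTx, Submodule.coe_zero] at h
      exact h.symm
    -- a.e. vanishing of the kernel integral, then everywhere by continuity
    haveI := isOpenPosMeasure_configMeasure (L := L)
    have hae : (fun U => ∫ V, transferKernel su2Rep β U V * v V ∂configMeasure SU2 L) =ᵐ[configMeasure SU2 L]
        (fun _ => (0 : ℝ)) := by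
      have h1 := hA v
      rw [hAv] at h1
      filter_upwards [h1, Lp.coeFn_zero ℝ 2 (configMeasure SU2 L)] with U hU h0
      rw [← hU, h0]
      rfl
    have hcont := continuous_transferApply_coe (L := L) β v
    have heq := (hcont.ae_eq_iff_eq (μ := configMeasure SU2 L) continuous_const).mp hae
    exact congr_fun heq U

end Summit.QuantumFields.YangMills.Theorems.FemtoTransferGap

end
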